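import Summits.CriticalPhenomena.PercolationContinuityZ3.Theorems.PercNearOneGluingNoHeavyQuantFarTwoTerminalReachOut
import Summits.CriticalPhenomena.PercolationContinuityZ3.Theorems.PercNearOneGluingNoHeavyQuantFarTwoTerminalExit
import HarnessLib

/-!
# QUANT lane R8, front "FAR beyond trees", layer one — TWO-TERMINAL BLOCKS II′: the law of the feedback — marginals of the OUTSIDE relays
# and the mass that passes through the block

builds on p205010 (kernel theorem, internal audit signed; external expert review pending)

Support file (`--supports stmt-CriticalPhenomena-4575`), seat `prim-quant-p1` (gen 25); memo
`run/shared/lean/prim/quant/prim-quant-p1-g25/FOR-LEAD-TWOTERMINAL.md` §2.  Standard axioms; no sorries; no definitions.  Law-level companion of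
`…QuantFarTwoTerminalReachOut` (configuration level) in the style of `…QuantFarTwoTerminalExit` (`Block.real_congr_of_twoTerminal`, independence of the
pairs meeting / avoiding `Z`).

For weights vanishing between the block `Z` and `(Z ∪ {c₁,c₂})ᶜ` (`o ∉ Z`), with `θ := P(c₁ ~ c₂ on Z)` the probability that the block is CROSSED:
* `Block.real_openConn_off₂_eq` — **marginal of an outside vertex** `b ∉ Z`:
  `P(o ↔ b) = P(o ~ b off Z) + θ · P(¬ o ~ b off Z ∧ ((o ~ c₁ off ∧ c₂ ~ b off) ∨ (o ~ c₂ off ∧ c₁ ~ b off)))` —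
  the second summand is the FEEDBACK through the block (linear in `θ`, the only inside number an outside marginal sees);
* `Block.real_openConn_off₂_ge` / `Block.real_openConn_off₂_le_add` — the two one-sided forms (`P(o ~ b off Z) ≤ P(o ↔ b) ≤ P(o ~ b off Z) + θ`), the first for
  ANY weights.
With `Block.real_openConn_in₂_eq` (inside marginals) this gives the observer's mean `EN = Σ_{b ∈ A∖Z} P(o↔b) + Σ_{a ∈ A∩Z} P(o↔a)` as an explicit bilinear form in
(outside type/connection law) × (`θ`, inside reach probabilities) — the `EN > 2` row of the two-terminal LP (memo §4).
[cite: Grimmett1999, §1.3 p. 10; §2.2] (product measure; events determined by finitely many coordinates); bookkeeping [this work].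
-/

noncomputable section

namespace Summit.CriticalPhenomena.PercolationContinuityZ3.Theorems

namespace Quant

namespace Block

open Finset MeasureTheory Set
open Literature.Probability.LatticeModels
open Literature.Probability.Percolation
open Bundle (offZ avoid offZ_eq_inter determinedBy_offZ reachable_of_offZ)
open scoped Classical

variable {n : ℕ}

section LawOut

variable {o c₁ c₂ : Fin n} {Z : Finset (Fin n)}

/-- **Marginal of an outside vertex, two terminals.**  For `b ∉ Z` (`o ∉ Z`, weights vanishing between `Z` and `(Z ∪ {c₁,c₂})ᶜ`):
`P(o ↔ b) = P(o ~ b off Z) + P(c₁ ~ c₂ on Z) · P(¬ o ~ b off Z ∧ ((o ~ c₁ off Z ∧ c₂ ~ b off Z) ∨ (o ~ c₂ off Z ∧ c₁ ~ b off Z)))`. [this work] -/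
theorem real_openConn_off₂_eq (v : Sym2 (Fin n) → unitInterval) (ho : o ∉ Z)
    (hv : ∀ x y : Fin n, x ≠ y → x ∈ Z → y ∉ Z → y ≠ c₁ → y ≠ c₂ → (v s(x, y) : ℝ) = 0) {b : Fin n} (hb : b ∉ Z) :
    (prodBernoulli v).real (openConn o b) =
      (prodBernoulli v).real {ω | offZ Z ω ∈ openConn o b} +
        (prodBernoulli v).real {ω | onZ Z ω ∈ openConn c₁ c₂} *
          (prodBernoulli v).real {ω | offZ Z ω ∉ openConn o b ∧
            ((offZ Z ω ∈ openConn o c₁ ∧ offZ Z ω ∈ openConn c₂ b) ∨ (offZ Z ω ∈ openConn o c₂ ∧ offZ Z ω ∈ openConn c₁ b))} := by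
  set μ := prodBernoulli v with hμ
  have hmeas : ∀ U : Set (BondConfig (Fin n)), MeasurableSet U := fun U => (Set.toFinite U).measurableSet
  set E₁ := {ω : BondConfig (Fin n) | offZ Z ω ∈ openConn o b} with hE₁
  set E₂ := {ω : BondConfig (Fin n) | offZ Z ω ∉ openConn o b ∧
    ((offZ Z ω ∈ openConn o c₁ ∧ offZ Z ω ∈ openConn c₂ b) ∨ (offZ Z ω ∈ openConn o c₂ ∧ offZ Z ω ∈ openConn c₁ b))} with hE₂
  set Y := {ω : BondConfig (Fin n) | onZ Z ω ∈ openConn c₁ c₂} with hY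
  set T := E₁ ∪ Y ∩ E₂ with hT
  have hST : μ.real (openConn o b) = μ.real T := by
    refine real_congr_of_twoTerminal (c₁ := c₁) (c₂ := c₂) (Z := Z) v hv _ _ fun ω hω => ?_
    simp only [hT, hE₁, hE₂, hY, Set.mem_union, Set.mem_inter_iff, mem_setOf_eq]
    show (openGraph ω).Reachable o b ↔ _
    rw [reach_off₂_iff hω ho hb]
    constructor
    · rintro (h | ⟨hon, h⟩)
      · exact Or.inl h
      · by_cases hob : (openGraph (offZ Z ω)).Reachable o b
        · exact Or.inl hob
        · exact Or.inr ⟨hon, hob, h⟩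
    · rintro (h | ⟨hon, -, h⟩)
      · exact Or.inl h
      · exact Or.inr ⟨hon, h⟩
  have hd : Disjoint E₁ (Y ∩ E₂) := by
    rw [Set.disjoint_left]; rintro ω h ⟨-, h', -⟩; exact h' h
  have hdY : DeterminedBy Y (↑(avoid Z) : Set (Sym2 (Fin n)))ᶜ := determinedBy_onZ Z fun η => η ∈ openConn c₁ c₂
  have hdE₂ : DeterminedBy E₂ (↑(avoid Z) : Set (Sym2 (Fin n))) :=
    determinedBy_offZ Z fun η => η ∉ openConn o b ∧ ((η ∈ openConn o c₁ ∧ η ∈ openConn c₂ b) ∨ (η ∈ openConn o c₂ ∧ η ∈ openConn c₁ b))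
  have hprod : μ.real (Y ∩ E₂) = μ.real Y * μ.real E₂ := by
    rw [Set.inter_comm, mul_comm]
    exact prodBernoulli_real_inter_of_determinedBy v (avoid Z) hdE₂ hdY (hmeas _) (hmeas _)
  rw [hST, hT, measureReal_union hd (hmeas _), hprod]

/-- **Outside vertices are reached at least off the block** (ANY weights): `P(o ~ b off Z) ≤ P(o ↔ b)`. [this work] -/
theorem real_openConn_off₂_ge (v : Sym2 (Fin n) → unitInterval) (o b : Fin n) (Z : Finset (Fin n)) :
    (prodBernoulli v).real {ω | offZ Z ω ∈ openConn o b} ≤ (prodBernoulli v).real (openConn o b : Set (BondConfig (Fin n))) :=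
  measureReal_mono (fun _ h => reachable_of_offZ h) (measure_ne_top _ _)

/-- **The feedback is at most the crossing probability**: for `b ∉ Z` (hypotheses of `real_openConn_off₂_eq`),
`P(o ↔ b) ≤ P(o ~ b off Z) + P(c₁ ~ c₂ on Z)`. [this work] -/
theorem real_openConn_off₂_le_add (v : Sym2 (Fin n) → unitInterval) (ho : o ∉ Z)
    (hv : ∀ x y : Fin n, x ≠ y → x ∈ Z → y ∉ Z → y ≠ c₁ → y ≠ c₂ → (v s(x, y) : ℝ) = 0) {b : Fin n} (hb : b ∉ Z) :
    (prodBernoulli v).real (openConn o b : Set (BondConfig (Fin n))) ≤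
      (prodBernoulli v).real {ω | offZ Z ω ∈ openConn o b} + (prodBernoulli v).real {ω | onZ Z ω ∈ openConn c₁ c₂} := by
  rw [real_openConn_off₂_eq (c₁ := c₁) (c₂ := c₂) v ho hv hb]
  have h1 : (prodBernoulli v).real {ω : BondConfig (Fin n) | offZ Z ω ∉ openConn o b ∧
      ((offZ Z ω ∈ openConn o c₁ ∧ offZ Z ω ∈ openConn c₂ b) ∨ (offZ Z ω ∈ openConn o c₂ ∧ offZ Z ω ∈ openConn c₁ b))} ≤ 1 :=
    measureReal_le_one
  have h0 : 0 ≤ (prodBernoulli v).real {ω : BondConfig (Fin n) | onZ Z ω ∈ openConn c₁ c₂} := measureReal_nonneg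
  nlinarith

end LawOut

end Block

end Quant

end Summit.CriticalPhenomena.PercolationContinuityZ3.Theorems
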